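import Mathlib
import HarnessLib

/-!
# The monomial split under an almost-decreasing weight

(Line `janus-bands`, crux `ArrangementNormalForm`, stub `stub_separateTwoPos`, part
`MonoSplit`.) The averaging brick replacing the lower fibre-mass bounds ("placement") of the
earlier roadmap for the case of a numerator VANISHING at a special point of the closed piece.
In blown-up coordinates `(x, v)` at the special point (`y = x v` on a thin sector adjacent to an
atom / polar / facet direction), let `W ≥ 0` be a measurable weight on `(0, 4δ) × (0, 4ε)` that
is ALMOST DECREASING TOWARDS THE CORNER at bounded scale:
`W(x, v) ≤ K · W(x', v')` whenever `x ≤ x' ≤ 4x`, `v ≤ v' ≤ 4v` (for the fibre mass this is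
`SepTwo.lmass_contract` radially about the point and angularly about the direction, with a
constant `K`; explicit power factors `x^a v^b`, `a, b ∈ ℤ`, are allowed). If a polynomial
`F(x, v) = ∑ c i j x^i v^j` satisfies `∫∫ |F| W < ∞` on the big box, then EVERY MONOMIAL does on
the small box `(0, δ) × (0, ε)` (`SepTwo.monoSplit`, registered as `separateTwo_monoSplit`):
pointwise, `|c i j| x^i v^j ≤ C (x v)⁻¹ ∫_{[x,4x]×[v,4v]} |F|` (norm equivalence on the dilated
box, part `NormEquiv`, consumed here through the hypothesis `hC`) and `W(x, v) ≤ K W` on that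
box; integrating, the kernel `(x v)⁻¹ 1_{x<ξ<4x, v<η<4v}` has `∫ dx dv = (log 4)²` for every
`(ξ, η)` (`SepTwo.lintegral_window_le`). No lower bound for `W` is used.
-/

noncomputable section

open Set MeasureTheory
open scoped ENNReal

namespace Summit.KontsevichZagierPeriods.ArrangementNormalForm.JanusBands

namespace SepTwo

/-- `∫⁻_{(η/4, η)} v⁻¹ dv = log 4` (as an inequality, all we need). -/
theorem lintegral_inv_Ioo_le {η : ℝ} (hη : 0 < η) :
    ∫⁻ v in Ioo (η / 4) η, ENNReal.ofReal v⁻¹ ≤ ENNReal.ofReal (Real.log 4) := by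
  have h4 : 0 < η / 4 := by positivity
  have hint : IntegrableOn (fun v : ℝ => v⁻¹) (Ioo (η / 4) η) := by
    have : IntegrableOn (fun v : ℝ => v⁻¹) (Icc (η / 4) η) :=
      (continuousOn_inv₀.mono fun v hv => ne_of_gt (h4.trans_le hv.1)).integrableOn_Icc
    exact this.mono_set Ioo_subset_Icc_self
  rw [← ofReal_integral_eq_lintegral_ofReal hint]
  · refine ENNReal.ofReal_le_ofReal (le_of_eq ?_)
    rw [← integral_Ioc_eq_integral_Ioo, ← intervalIntegral.integral_of_le (by linarith),
      integral_inv_of_pos h4 hη]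
    congr 1
    field_simp
  · filter_upwards [ae_restrict_mem measurableSet_Ioo] with v hv
    exact inv_nonneg.2 (h4.le.trans hv.1.le)

/-- The window kernel is measurable. -/
theorem measurableSet_window :
    MeasurableSet {p : ℝ × ℝ | p.1 < p.2 ∧ p.2 < 4 * p.1} :=
  (measurableSet_lt measurable_fst measurable_snd).inter
    (measurableSet_lt measurable_snd (measurable_fst.const_mul 4))

/-- **Averaging lemma (one variable).** For measurable `g ≥ 0`:
`∫⁻_{(0,ε)} v⁻¹ ∫⁻_{(v,4v)} g ≤ log 4 · ∫⁻_{(0,4ε)} g`. -/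
theorem lintegral_window_le (g : ℝ → ℝ≥0∞) (hg : Measurable g) (ε : ℝ) :
    ∫⁻ v in Ioo 0 ε, ENNReal.ofReal v⁻¹ * ∫⁻ η in Ioo v (4 * v), g η ≤
      ENNReal.ofReal (Real.log 4) * ∫⁻ η in Ioo 0 (4 * ε), g η := by
  set S : Set (ℝ × ℝ) := {p | p.1 < p.2 ∧ p.2 < 4 * p.1} with hS
  set Φ : ℝ → ℝ → ℝ≥0∞ := fun v η => ENNReal.ofReal v⁻¹ * S.indicator (fun p => g p.2) (v, η)
    with hΦ
  have hΦm : Measurable (Function.uncurry Φ) := by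
    refine Measurable.mul (ENNReal.measurable_ofReal.comp (measurable_inv.comp measurable_fst)) ?_
    exact (hg.comp measurable_snd).indicator measurableSet_window
  -- Step 1: rewrite the inner window integral as an integral over (0, 4ε) of Φ.
  have h1 : ∀ v ∈ Ioo (0 : ℝ) ε, ENNReal.ofReal v⁻¹ * ∫⁻ η in Ioo v (4 * v), g η =
      ∫⁻ η in Ioo 0 (4 * ε), Φ v η := by
    intro v hv
    have hsub : Ioo v (4 * v) ⊆ Ioo 0 (4 * ε) := Ioo_subset_Ioo hv.1.le (by linarith [hv.2])
    have hind : ∀ η, S.indicator (fun p : ℝ × ℝ => g p.2) (v, η) = (Ioo v (4 * v)).indicator g η := by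
      intro η
      simp only [indicator_apply, hS, mem_setOf_eq, mem_Ioo]
    simp only [hΦ, hind]
    rw [lintegral_const_mul _ (hg.indicator measurableSet_Ioo), lintegral_indicator measurableSet_Ioo,
      Measure.restrict_restrict measurableSet_Ioo, inter_eq_left.2 hsub]
  rw [setLIntegral_congr_fun measurableSet_Ioo h1]
  -- Step 2: swap.
  rw [lintegral_lintegral_swap (hΦm.aemeasurable)]
  -- Step 3: inner bound for fixed η.
  have h3 : ∀ η ∈ Ioo (0 : ℝ) (4 * ε), ∫⁻ v in Ioo 0 ε, Φ v η ≤ ENNReal.ofReal (Real.log 4) * g η := by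
    intro η hη
    have hpt : ∀ v, Φ v η ≤ (Ioo (η / 4) η).indicator (fun v => ENNReal.ofReal v⁻¹) v * g η := by
      intro v
      simp only [hΦ, indicator_apply, hS, mem_setOf_eq, mem_Ioo]
      by_cases h : v < η ∧ η < 4 * v
      · rw [if_pos h, if_pos ⟨by linarith [h.2], h.1⟩]
      · rw [if_neg h, mul_zero]; exact zero_le
    calc ∫⁻ v in Ioo 0 ε, Φ v η
        ≤ ∫⁻ v in Ioo 0 ε, (Ioo (η / 4) η).indicator (fun v => ENNReal.ofReal v⁻¹) v * g η :=
          lintegral_mono fun v => hpt v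
      _ ≤ ∫⁻ v, (Ioo (η / 4) η).indicator (fun v => ENNReal.ofReal v⁻¹) v * g η :=
          lintegral_mono' Measure.restrict_le_self le_rfl
      _ = (∫⁻ v in Ioo (η / 4) η, ENNReal.ofReal v⁻¹) * g η := by
          have hm : Measurable fun v : ℝ => (Ioo (η / 4) η).indicator (fun v => ENNReal.ofReal v⁻¹) v :=
            (ENNReal.measurable_ofReal.comp measurable_inv).indicator measurableSet_Ioo
          rw [lintegral_mul_const _ hm, lintegral_indicator measurableSet_Ioo]
      _ ≤ ENNReal.ofReal (Real.log 4) * g η :=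
          mul_le_mul_left (lintegral_inv_Ioo_le hη.1) _
  calc ∫⁻ η in Ioo 0 (4 * ε), ∫⁻ v in Ioo 0 ε, Φ v η
      ≤ ∫⁻ η in Ioo 0 (4 * ε), ENNReal.ofReal (Real.log 4) * g η :=
        setLIntegral_mono' measurableSet_Ioo h3
    _ = ENNReal.ofReal (Real.log 4) * ∫⁻ η in Ioo 0 (4 * ε), g η := lintegral_const_mul _ hg

/-- Window integrals of a jointly measurable kernel are jointly measurable in
(lower end of the window, parameter). -/
theorem measurable_window_lintegral (G : ℝ → ℝ → ℝ≥0∞) (hG : Measurable (Function.uncurry G)) :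
    Measurable fun p : ℝ × ℝ => ∫⁻ η in Ioo p.1 (4 * p.1), G p.2 η := by
  set T : Set ((ℝ × ℝ) × ℝ) := {q | q.1.1 < q.2 ∧ q.2 < 4 * q.1.1} with hT_def
  have hT : MeasurableSet T :=
    (measurableSet_lt (measurable_fst.comp measurable_fst) measurable_snd).inter
      (measurableSet_lt measurable_snd ((measurable_fst.comp measurable_fst).const_mul 4))
  have hF : Measurable (T.indicator fun q : (ℝ × ℝ) × ℝ => G q.1.2 q.2) :=
    (hG.comp ((measurable_snd.comp measurable_fst).prodMk measurable_snd)).indicator hT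
  have heq : (fun p : ℝ × ℝ => ∫⁻ η in Ioo p.1 (4 * p.1), G p.2 η) =
      fun p => ∫⁻ η, T.indicator (fun q : (ℝ × ℝ) × ℝ => G q.1.2 q.2) (p, η) := by
    funext p
    rw [← lintegral_indicator measurableSet_Ioo]
    rfl
  rw [heq]
  exact hF.lintegral_prod_right'

/-- Real box integrals of a continuous non-negative function as iterated lower integrals. -/
theorem ofReal_box_integral (F : ℝ → ℝ → ℝ) (hF : Continuous (Function.uncurry F))
    (hF0 : ∀ ξ η, 0 ≤ F ξ η) {x v : ℝ} (hx : 0 ≤ x) (hv : 0 ≤ v) :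
    ENNReal.ofReal (∫ ξ in x..4 * x, ∫ η in v..4 * v, F ξ η) =
      ∫⁻ ξ in Ioo x (4 * x), ∫⁻ η in Ioo v (4 * v), ENNReal.ofReal (F ξ η) := by
  have hx4 : x ≤ 4 * x := by linarith
  have hv4 : v ≤ 4 * v := by linarith
  have hin : ∀ ξ, ENNReal.ofReal (∫ η in v..4 * v, F ξ η) =
      ∫⁻ η in Ioo v (4 * v), ENNReal.ofReal (F ξ η) := by
    intro ξ
    have hc : Continuous (F ξ) := hF.uncurry_left ξ
    rw [intervalIntegral.integral_of_le hv4,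
      ofReal_integral_eq_lintegral_ofReal (hc.integrableOn_Icc.mono_set Ioc_subset_Icc_self)
        (ae_of_all _ fun η => hF0 ξ η)]
    exact setLIntegral_congr Ioo_ae_eq_Ioc.symm
  have hI : Continuous fun ξ => ∫ η in v..4 * v, F ξ η :=
    intervalIntegral.continuous_parametric_intervalIntegral_of_continuous' hF _ _
  have hI0 : ∀ ξ, 0 ≤ ∫ η in v..4 * v, F ξ η := fun ξ =>
    intervalIntegral.integral_nonneg hv4 fun η _ => hF0 ξ η
  rw [intervalIntegral.integral_of_le hx4,
    ofReal_integral_eq_lintegral_ofReal (hI.integrableOn_Icc.mono_set Ioc_subset_Icc_self)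
      (ae_of_all _ fun ξ => hI0 ξ), setLIntegral_congr Ioo_ae_eq_Ioc.symm]
  exact lintegral_congr fun ξ => hin ξ

/-- **The monomial split under an almost-decreasing weight.** See the module docstring; the
norm-equivalence constant of part `NormEquiv` enters through `hC`. -/
theorem monoSplit (d : ℕ) (C : ℝ)
    (hC : ∀ (c : Fin (d + 1) → Fin (d + 1) → ℝ) (i j : Fin (d + 1)) (x v : ℝ), 0 < x → 0 < v →
      |c i j| * x ^ (i : ℕ) * v ^ (j : ℕ) * (x * v) ≤
        C * ∫ ξ in x..4 * x, ∫ η in v..4 * v, |∑ i', ∑ j', c i' j' * ξ ^ (i' : ℕ) * η ^ (j' : ℕ)|)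
    (c : Fin (d + 1) → Fin (d + 1) → ℝ) (W : ℝ → ℝ → ℝ≥0∞) (hW : Measurable (Function.uncurry W))
    (K : ℝ≥0∞) (hK : K ≠ ∞) (δ ε : ℝ)
    (hmono : ∀ x v x' v', 0 < x → x ≤ x' → x' ≤ 4 * x → x' < 4 * δ → 0 < v → v ≤ v' →
      v' ≤ 4 * v → v' < 4 * ε → W x v ≤ K * W x' v')
    (hfin : ∫⁻ x in Ioo 0 (4 * δ), ∫⁻ v in Ioo 0 (4 * ε),
      ENNReal.ofReal |∑ i', ∑ j', c i' j' * x ^ (i' : ℕ) * v ^ (j' : ℕ)| * W x v < ∞)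
    (i j : Fin (d + 1)) :
    ∫⁻ x in Ioo 0 δ, ∫⁻ v in Ioo 0 ε,
      ENNReal.ofReal (|c i j| * x ^ (i : ℕ) * v ^ (j : ℕ)) * W x v < ∞ := by
  set F : ℝ → ℝ → ℝ := fun ξ η => |∑ i', ∑ j', c i' j' * ξ ^ (i' : ℕ) * η ^ (j' : ℕ)| with hF_def
  have hFc : Continuous (Function.uncurry F) := by
    simp only [hF_def]
    fun_prop
  have hF0 : ∀ ξ η, 0 ≤ F ξ η := fun ξ η => abs_nonneg _
  set G : ℝ → ℝ → ℝ≥0∞ := fun ξ η => ENNReal.ofReal (F ξ η) * W ξ η with hG_def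
  have hGm : Measurable (Function.uncurry G) :=
    (ENNReal.measurable_ofReal.comp hFc.measurable).mul hW
  set Φ : ℝ → ℝ → ℝ≥0∞ := fun v ξ => ∫⁻ η in Ioo v (4 * v), G ξ η with hΦ_def
  have hΦm : Measurable (Function.uncurry Φ) := measurable_window_lintegral G hGm
  set Ψ : ℝ → ℝ≥0∞ := fun ξ => ∫⁻ η in Ioo 0 (4 * ε), G ξ η with hΨ_def
  have hΨm : Measurable Ψ := hGm.lintegral_prod_right'
  set A : ℝ≥0∞ := ENNReal.ofReal C * K with hA_def
  have hA : A ≠ ∞ := ENNReal.mul_ne_top ENNReal.ofReal_ne_top hK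
  -- pointwise bound
  have hpt : ∀ x ∈ Ioo (0 : ℝ) δ, ∀ v ∈ Ioo (0 : ℝ) ε,
      ENNReal.ofReal (|c i j| * x ^ (i : ℕ) * v ^ (j : ℕ)) * W x v ≤
        A * (ENNReal.ofReal x⁻¹ * ∫⁻ ξ in Ioo x (4 * x), ENNReal.ofReal v⁻¹ * Φ v ξ) := by
    intro x hx v hv
    have hxv : 0 < x * v := mul_pos hx.1 hv.1
    set R : ℝ := ∫ ξ in x..4 * x, ∫ η in v..4 * v, F ξ η with hR_def
    have hR0 : 0 ≤ R := intervalIntegral.integral_nonneg (by linarith [hx.1]) fun ξ _ =>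
      intervalIntegral.integral_nonneg (by linarith [hv.1]) fun η _ => hF0 ξ η
    have h1 : |c i j| * x ^ (i : ℕ) * v ^ (j : ℕ) ≤ C * (x⁻¹ * (v⁻¹ * R)) := by
      have h : |c i j| * x ^ (i : ℕ) * v ^ (j : ℕ) * (x * v) ≤ C * R := hC c i j x v hx.1 hv.1
      calc |c i j| * x ^ (i : ℕ) * v ^ (j : ℕ)
          = |c i j| * x ^ (i : ℕ) * v ^ (j : ℕ) * (x * v) * (x * v)⁻¹ := by
            rw [mul_inv_cancel_right₀ hxv.ne']
        _ ≤ C * R * (x * v)⁻¹ := mul_le_mul_of_nonneg_right h (inv_nonneg.2 hxv.le)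
        _ = C * (x⁻¹ * (v⁻¹ * R)) := by rw [mul_inv]; ring
    have hR : ENNReal.ofReal R = ∫⁻ ξ in Ioo x (4 * x), ∫⁻ η in Ioo v (4 * v),
        ENNReal.ofReal (F ξ η) := ofReal_box_integral F hFc hF0 hx.1.le hv.1.le
    have h2 : ENNReal.ofReal (|c i j| * x ^ (i : ℕ) * v ^ (j : ℕ)) ≤
        ENNReal.ofReal C * (ENNReal.ofReal x⁻¹ * (ENNReal.ofReal v⁻¹ * ENNReal.ofReal R)) := by
      calc ENNReal.ofReal (|c i j| * x ^ (i : ℕ) * v ^ (j : ℕ))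
          ≤ ENNReal.ofReal (C * (x⁻¹ * (v⁻¹ * R))) := ENNReal.ofReal_le_ofReal h1
        _ = ENNReal.ofReal C * ENNReal.ofReal (x⁻¹ * (v⁻¹ * R)) :=
            ENNReal.ofReal_mul' (mul_nonneg (inv_nonneg.2 hx.1.le)
              (mul_nonneg (inv_nonneg.2 hv.1.le) hR0))
        _ = _ := by
          rw [ENNReal.ofReal_mul (inv_nonneg.2 hx.1.le), ENNReal.ofReal_mul (inv_nonneg.2 hv.1.le)]
    -- the inner comparison of the weight
    have h3 : (∫⁻ ξ in Ioo x (4 * x), ∫⁻ η in Ioo v (4 * v), ENNReal.ofReal (F ξ η)) * W x v ≤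
        K * ∫⁻ ξ in Ioo x (4 * x), Φ v ξ := by
      calc (∫⁻ ξ in Ioo x (4 * x), ∫⁻ η in Ioo v (4 * v), ENNReal.ofReal (F ξ η)) * W x v
          ≤ ∫⁻ ξ in Ioo x (4 * x), (∫⁻ η in Ioo v (4 * v), ENNReal.ofReal (F ξ η)) * W x v :=
            lintegral_mul_const_le _ _
        _ ≤ ∫⁻ ξ in Ioo x (4 * x), ∫⁻ η in Ioo v (4 * v), ENNReal.ofReal (F ξ η) * W x v :=
            lintegral_mono fun ξ => lintegral_mul_const_le _ _
        _ ≤ ∫⁻ ξ in Ioo x (4 * x), ∫⁻ η in Ioo v (4 * v), K * G ξ η := by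
            refine setLIntegral_mono' measurableSet_Ioo fun ξ hξ =>
              setLIntegral_mono' measurableSet_Ioo fun η hη => ?_
            rw [hG_def, mul_left_comm]
            exact mul_le_mul_right (hmono x v ξ η hx.1 hξ.1.le hξ.2.le (by linarith [hξ.2, hx.2])
              hv.1 hη.1.le hη.2.le (by linarith [hη.2, hv.2])) _
        _ = K * ∫⁻ ξ in Ioo x (4 * x), Φ v ξ := by
            rw [← lintegral_const_mul K (Measurable.of_uncurry_left hΦm)]
            refine lintegral_congr fun ξ => ?_
            exact lintegral_const_mul K (Measurable.of_uncurry_left hGm)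
    calc ENNReal.ofReal (|c i j| * x ^ (i : ℕ) * v ^ (j : ℕ)) * W x v
        ≤ ENNReal.ofReal C * (ENNReal.ofReal x⁻¹ * (ENNReal.ofReal v⁻¹ * ENNReal.ofReal R)) * W x v :=
          mul_le_mul_left h2 _
      _ = ENNReal.ofReal C * (ENNReal.ofReal x⁻¹ * (ENNReal.ofReal v⁻¹ *
          ((∫⁻ ξ in Ioo x (4 * x), ∫⁻ η in Ioo v (4 * v), ENNReal.ofReal (F ξ η)) * W x v))) := by
          rw [hR]; ring
      _ ≤ ENNReal.ofReal C * (ENNReal.ofReal x⁻¹ * (ENNReal.ofReal v⁻¹ *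
          (K * ∫⁻ ξ in Ioo x (4 * x), Φ v ξ))) := by gcongr
      _ = A * (ENNReal.ofReal x⁻¹ * ∫⁻ ξ in Ioo x (4 * x), ENNReal.ofReal v⁻¹ * Φ v ξ) := by
          rw [hA_def, lintegral_const_mul _ (Measurable.of_uncurry_left hΦm)]
          ring
  -- integrate the pointwise bound
  have hmeas_vξ : Measurable (Function.uncurry fun v ξ => ENNReal.ofReal v⁻¹ * Φ v ξ) :=
    (ENNReal.measurable_ofReal.comp (measurable_inv.comp measurable_fst)).mul hΦm
  have hinner : ∀ x, ∫⁻ v in Ioo 0 ε, ∫⁻ ξ in Ioo x (4 * x), ENNReal.ofReal v⁻¹ * Φ v ξ ≤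
      ENNReal.ofReal (Real.log 4) * ∫⁻ ξ in Ioo x (4 * x), Ψ ξ := by
    intro x
    rw [lintegral_lintegral_swap (hmeas_vξ.aemeasurable)]
    calc ∫⁻ ξ in Ioo x (4 * x), ∫⁻ v in Ioo 0 ε, ENNReal.ofReal v⁻¹ * Φ v ξ
        ≤ ∫⁻ ξ in Ioo x (4 * x), ENNReal.ofReal (Real.log 4) * Ψ ξ :=
          lintegral_mono fun ξ => lintegral_window_le (G ξ) hGm.of_uncurry_left ε
      _ = ENNReal.ofReal (Real.log 4) * ∫⁻ ξ in Ioo x (4 * x), Ψ ξ := lintegral_const_mul _ hΨm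
  have houter : ∫⁻ x in Ioo 0 δ, ENNReal.ofReal x⁻¹ * ∫⁻ ξ in Ioo x (4 * x), Ψ ξ ≤
      ENNReal.ofReal (Real.log 4) * ∫⁻ ξ in Ioo 0 (4 * δ), Ψ ξ := lintegral_window_le Ψ hΨm δ
  have hL : ENNReal.ofReal (Real.log 4) ≠ ∞ := ENNReal.ofReal_ne_top
  calc ∫⁻ x in Ioo 0 δ, ∫⁻ v in Ioo 0 ε, ENNReal.ofReal (|c i j| * x ^ (i : ℕ) * v ^ (j : ℕ)) * W x v
      ≤ ∫⁻ x in Ioo 0 δ, ∫⁻ v in Ioo 0 ε,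
          A * (ENNReal.ofReal x⁻¹ * ∫⁻ ξ in Ioo x (4 * x), ENNReal.ofReal v⁻¹ * Φ v ξ) :=
        setLIntegral_mono' measurableSet_Ioo fun x hx =>
          setLIntegral_mono' measurableSet_Ioo fun v hv => hpt x hx v hv
    _ = A * ∫⁻ x in Ioo 0 δ, ENNReal.ofReal x⁻¹ *
          ∫⁻ v in Ioo 0 ε, ∫⁻ ξ in Ioo x (4 * x), ENNReal.ofReal v⁻¹ * Φ v ξ := by
        rw [← lintegral_const_mul' A _ hA]
        refine lintegral_congr fun x => ?_
        rw [lintegral_const_mul' A _ hA, lintegral_const_mul' _ _ ENNReal.ofReal_ne_top]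
    _ ≤ A * ∫⁻ x in Ioo 0 δ, ENNReal.ofReal x⁻¹ *
          (ENNReal.ofReal (Real.log 4) * ∫⁻ ξ in Ioo x (4 * x), Ψ ξ) := by
        gcongr with x
        exact hinner x
    _ = A * ENNReal.ofReal (Real.log 4) *
          ∫⁻ x in Ioo 0 δ, ENNReal.ofReal x⁻¹ * ∫⁻ ξ in Ioo x (4 * x), Ψ ξ := by
        have hre : ∀ x : ℝ, ENNReal.ofReal x⁻¹ *
            (ENNReal.ofReal (Real.log 4) * ∫⁻ ξ in Ioo x (4 * x), Ψ ξ) =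
            ENNReal.ofReal (Real.log 4) * (ENNReal.ofReal x⁻¹ * ∫⁻ ξ in Ioo x (4 * x), Ψ ξ) :=
          fun x => by ring
        simp_rw [hre]
        rw [lintegral_const_mul' _ _ hL]
        ring
    _ ≤ A * ENNReal.ofReal (Real.log 4) *
          (ENNReal.ofReal (Real.log 4) * ∫⁻ ξ in Ioo 0 (4 * δ), Ψ ξ) := by
        gcongr
    _ < ∞ := ENNReal.mul_lt_top (ENNReal.mul_lt_top hA.lt_top ENNReal.ofReal_lt_top)
        (ENNReal.mul_lt_top ENNReal.ofReal_lt_top hfin)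

end SepTwo

/-- **The monomial split under an almost-decreasing weight** (registered part of
`stub_separateTwoPos`; literal form of `SepTwo.monoSplit`): if `W ≥ 0` is measurable and
almost decreasing towards the corner at scale `4` on `(0, 4δ) × (0, 4ε)` and the polynomial
`∑ c i' j' x^{i'} v^{j'}` is absolutely integrable against `W` there, then so is every monomial
`c i j x^i v^j` on `(0, δ) × (0, ε)`; the norm-equivalence constant of part `NormEquiv`
(`separateTwo_normEquiv`) is the hypothesis `hC`. -/
theorem separateTwo_monoSplit (d : ℕ) (C : ℝ) (hC : ∀ (c : Fin (d + 1) → Fin (d + 1) → ℝ) (i j : Fin (d + 1)) (x v : ℝ), 0 < x → 0 < v → |c i j| * x ^ (i : ℕ) * v ^ (j : ℕ) * (x * v) ≤ C * ∫ ξ in x..4 * x, ∫ η in v..4 * v, |∑ i' : Fin (d + 1), ∑ j' : Fin (d + 1), c i' j' * ξ ^ (i' : ℕ) * η ^ (j' : ℕ)|) (c : Fin (d + 1) → Fin (d + 1) → ℝ) (W : ℝ → ℝ → ENNReal) (hW : Measurable (Function.uncurry W)) (K : ENNReal) (hK : K ≠ ⊤) (δ ε : ℝ) (hmono : ∀ x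 v x' v' : ℝ, 0 < x → x ≤ x' → x' ≤ 4 * x → x' < 4 * δ → 0 < v → v ≤ v' → v' ≤ 4 * v → v' < 4 * ε → W x v ≤ K * W x' v') (hfin : MeasureTheory.lintegral (MeasureTheory.volume.restrict (Set.Ioo 0 (4 * δ))) (fun x => MeasureTheory.lintegral (MeasureTheory.volume.restrict (Set.Ioo 0 (4 * ε))) (fun v => ENNReal.ofReal |∑ i' : Fin (d + 1), ∑ j' : Fin (d + 1), c i' j' * x ^ (i' : ℕ) * v ^ (j' : ℕ)| * W x v)) < ⊤) (i j : Fin (d + 1)) : MeasureTheory.lintegral (MeasureTheory.volume.restrict (Set.Ioo 0 δ)) (fun x => MeasureTheory.lintegral (MeasureTheory.volume.restrict (Set.Ioo 0 ε)) (fun v => ENNReal.ofReal (|c i j| * x ^ (i : ℕ) * v ^ (j : ℕ)) * W x v)) < ⊤ := by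
  exact SepTwo.monoSplit d C hC c W hW K hK δ ε hmono hfin i j


end Summit.KontsevichZagierPeriods.ArrangementNormalForm.JanusBands
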